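import Literature.NumberTheory.EllipticCurves.TamagawaProofs
import Literature.NumberTheory.EllipticCurves.ReductionHomomorphism
import Literature.NumberTheory.DiophantineGeometry.LocalReductionFiniteBadPlacesProofs
import HarnessLib

/-!
# Tamagawa numbers: `E₀(K)` is a subgroup, `c_v = 1` at good places (proofs)

Second sibling proof file (theorems only) of `Tamagawa.lean` (trunk T-ELLARITH, item C16), next to
`TamagawaProofs.lean` (which discharges `localTamagawaNumber_eq_one_of_hasGoodReduction`), and the bridge
between its predicate `WeierstrassCurve.IsNonsingularReductionPoint R W` (`E₀(K)` of an `R`-minimal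
equation `W / K` over a discrete valuation ring `R`, phrased with Mathlib's `W.reduction R`) and
the general `WeierstrassCurve.HasNonsingularReduction W₀` of `ReductionHomomorphism.lean`
(any valuation ring, `W₀` an equation with coefficients in the ring).  It discharges the named facts

* `WeierstrassCurve.mem_goodReductionSubgroup_iff` — the set of `K`-points with nonsingular
  reduction is a subgroup, so that membership in
  `W.goodReductionSubgroup R = AddSubgroup.closure {P | W.IsNonsingularReductionPoint R P}` is the
  predicate itself (Silverman, *AEC* VII.2.1: "`E₀(K)` is a subgroup of `E(K)`"); this is
  `WeierstrassCurve.HasNonsingularReduction.add/.neg` of `ReductionHomomorphism` for the discrete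
  valuation ring `R` with its canonical valuation `ValuationRing.valuation R K`, after writing
  `W = W₀.baseChange K` (`WeierstrassCurve.IsIntegral`) and identifying Mathlib's chosen integral
  model: `(W₀.baseChange K).integralModel R = W₀` (`integralModel_baseChange_eq`), hence
  `(W₀.baseChange K).reduction R = W₀.map (IsLocalRing.residue R)` and
  `(W₀.baseChange K).IsNonsingularReductionPoint R P ↔ W₀.HasNonsingularReduction P`;
* `WeierstrassCurve.localTamagawaNumber_eq_one_of_hasGoodReductionAt` — the place-indexed form of
  `WeierstrassCurve.localTamagawaNumber_eq_one_of_hasGoodReduction` (discharged in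
  `TamagawaProofs.lean`: if the minimal model has good reduction then `E₀(K) = E(K)` and
  `c(E/K) = [E(K) : E₀(K)] = 1`, Silverman, *AEC* VII.2, remark after Prop. 2.1);
* `WeierstrassCurve.mulSupport_localTamagawaNumber_finite` — for an elliptic curve over a number
  field, `c_v = 1` outside the finite set of bad places (`WeierstrassCurve.finite_badPlaces_holds`).

## References

* J. H. Silverman, *The Arithmetic of Elliptic Curves*, 2nd ed. (2009), VII.2 Prop. 2.1 and the
  remark following it (PDF pp. 167–169). [SilvermanAEC2009]

## Design

No definitions, no `sorry`; `noncomputable section`, `open scoped Classical`.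
-/

noncomputable section

open scoped Classical

namespace WeierstrassCurve

section Local

variable (R : Type*) [CommRing R] [IsDomain R] [IsDiscreteValuationRing R] {K : Type*}
  [Field K] [Algebra R K] [IsFractionRing R K]

omit [IsDomain R] [IsDiscreteValuationRing R] in
/-- Mathlib's chosen integral model of the base change of an equation `W₀` with coefficients in
`R` is `W₀` itself (`algebraMap R K` is injective). [folklore] -/
theorem integralModel_baseChange_eq (W₀ : WeierstrassCurve R) [(W₀.baseChange K).IsIntegral R] :
    (W₀.baseChange K).integralModel R = W₀ :=
  WeierstrassCurve.map_injective (IsFractionRing.injective R K)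
    (baseChange_integralModel_eq R (W₀.baseChange K))

/-- Hence Mathlib's reduction of `W₀.baseChange K` is `W₀` reduced coefficientwise. [folklore] -/
theorem reduction_baseChange_eq (W₀ : WeierstrassCurve R) [(W₀.baseChange K).IsMinimal R] :
    (W₀.baseChange K).reduction R = W₀.map (IsLocalRing.residue R) := by
  rw [WeierstrassCurve.reduction, integralModel_baseChange_eq]

/-- **Bridge `Tamagawa` ↔ `ReductionHomomorphism`.**  For an equation `W₀` with coefficients in the
discrete valuation ring `R` whose base change to `K` is `R`-minimal, the predicate
`IsNonsingularReductionPoint` of `Tamagawa.lean` on `K`-points of `W₀.baseChange K` is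
`WeierstrassCurve.HasNonsingularReduction W₀`. [folklore] -/
theorem isNonsingularReductionPoint_iff_hasNonsingularReduction (W₀ : WeierstrassCurve R)
    [(W₀.baseChange K).IsMinimal R] (P : (W₀.baseChange K).toAffine.Point) :
    (W₀.baseChange K).IsNonsingularReductionPoint R P ↔ W₀.HasNonsingularReduction P := by
  rcases P with _ | ⟨x, y, h⟩
  · exact Iff.rfl
  · simp only [IsNonsingularReductionPoint, HasNonsingularReduction, reduction_baseChange_eq]

/-- **`E₀(K)` of `Tamagawa.lean` is the subgroup `E₀` of `ReductionHomomorphism.lean`** (for the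
canonical valuation of the discrete valuation ring `R`); in particular the `AddSubgroup.closure`
in the definition of `WeierstrassCurve.goodReductionSubgroup` is superfluous
(Silverman, *AEC* VII.2.1: "`E₀(K)` is a subgroup").
[cite: SilvermanAEC2009, VII.2 Prop. 2.1 (PDF p. 167)] -/
theorem goodReductionSubgroup_baseChange_eq (W₀ : WeierstrassCurve R)
    [(W₀.baseChange K).IsMinimal R] :
    (W₀.baseChange K).goodReductionSubgroup R =
      W₀.nonsingularReductionSubgroup (Literature.NumberTheory.EllipticCurves.integers_valuationRing_valuation R K) := by
  have hset : {P | (W₀.baseChange K).IsNonsingularReductionPoint R P} =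
      (W₀.nonsingularReductionSubgroup (Literature.NumberTheory.EllipticCurves.integers_valuationRing_valuation R K) :
        Set (W₀.baseChange K).toAffine.Point) :=
    Set.ext fun P ↦ isNonsingularReductionPoint_iff_hasNonsingularReduction R W₀ P
  change AddSubgroup.closure {P | (W₀.baseChange K).IsNonsingularReductionPoint R P} = _
  rw [hset, AddSubgroup.closure_eq]

variable (W : WeierstrassCurve K)

/-- Discharge of `WeierstrassCurve.mem_goodReductionSubgroup_iff`: **`E₀(K)` is a subgroup**
(Silverman, *AEC* VII.2.1), so membership in `W.goodReductionSubgroup R` (defined as the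
`AddSubgroup.closure` of the set of points with nonsingular reduction) is the predicate
`W.IsNonsingularReductionPoint R`. [cite: SilvermanAEC2009, VII.2 Prop. 2.1 (PDF pp. 167–169)] -/
theorem mem_goodReductionSubgroup_iff_holds : W.mem_goodReductionSubgroup_iff R := by
  intro _ P
  obtain ⟨W₀, rfl⟩ : ∃ W₀ : WeierstrassCurve R, W = W₀.baseChange K := IsIntegral.integral
  rw [goodReductionSubgroup_baseChange_eq, mem_nonsingularReductionSubgroup_iff,
    isNonsingularReductionPoint_iff_hasNonsingularReduction]

end Local

section NumberField

open IsDedekindDomain NumberField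

variable {K : Type*} [Field K] [NumberField K] (W : WeierstrassCurve K)

/-- Discharge of `WeierstrassCurve.localTamagawaNumber_eq_one_of_hasGoodReductionAt`: `c_v = 1` at
a finite place `v` of good reduction.
[cite: SilvermanAEC2009, VII.2 remark after Prop. 2.1 (PDF p. 169)] -/
theorem localTamagawaNumber_eq_one_of_hasGoodReductionAt_holds :
    W.localTamagawaNumber_eq_one_of_hasGoodReductionAt := by
  intro v h
  haveI : ((W.baseChange (v.adicCompletion K)).minimal
      (v.adicCompletionIntegers K)).HasGoodReduction (v.adicCompletionIntegers K) := h
  exact localTamagawaNumber_eq_one_of_hasGoodReduction_holds _ _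

/-- Discharge of `WeierstrassCurve.mulSupport_localTamagawaNumber_finite`: for an elliptic curve
over a number field, `c_v = 1` for all but finitely many finite places `v`, namely outside the
finite set of bad places (`WeierstrassCurve.finite_badPlaces_holds`, Silverman *AEC* VIII.1
Remark 1.3, with `c_v = 1` at good `v`).
[cite: SilvermanAEC2009, VII.2 remark after Prop. 2.1 (PDF p. 169) with VIII.1 Remark 1.3] -/
theorem mulSupport_localTamagawaNumber_finite_holds :
    W.mulSupport_localTamagawaNumber_finite := by
  intro _
  refine (W.finite_badPlaces_holds (𝓞 K)).subset fun v hv ↦ ?_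
  rw [mem_badPlaces_iff]
  intro hgood
  exact hv (W.localTamagawaNumber_eq_one_of_hasGoodReductionAt_holds v hgood)

end NumberField

end WeierstrassCurve
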